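import Mathlib
import Summits.Ventures.HodgeRepro2.Tier7.Line1.SepOmega
import Summits.Ventures.HodgeRepro2.Tier7.Line1.SepWeightComm

/-!
# Tier7/Line1/SepCenter — the centre of `G` on the summands (H11a) and the product of the theta classes (H11b)

The SEPARATING DATUM of t7-L1-p2 (LINE L1, residual probe). A central element `z` of `G` commutes with the flips
and signs, so on `U` it is an operator in the commutant of `SepWeightComm` and acts by a scalar on each `Wmod s`
(`exists_scalar_omegaA`); on `E2 = ⟨e₀, e₁⟩` the index sign and the swap force a scalar (`exists_scalar_E2`). For
(H11b): the product `θ₀ θ₁ · conj(θ₂ θ₃)` of classes of the four summands is a multiple of the top class `t₁ t₂`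
(`prod_eq_smul_topT`), which `G` fixes (`smul_topT`), so the centre fixes the product (`center_fixes_prod`).
Author: t7-L1-p2 (prover-pub-hodge-repro2-t7-L1-p2-g0-0). §8(d): NO.
-/

namespace Summit.Ventures.HodgeRepro2.Tier7.Line1.Sep

open Finset Summit.Ventures.HodgeRepro2.Tier7

noncomputable section

variable {J : Type} [AddCommGroup J] [Module ℂ J]

/-! ## Linearity of the action -/

/-- the action is additive -/
theorem smul_add' (g : G) (a b : HXS J) : g • (a + b) = g • a + g • b :=
  map_add (FreeGroup.lift (gen J) g) a b

/-- the action is `ℂ`-linear -/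
theorem smul_smul' (g : G) (c : ℂ) (a : HXS J) : g • (c • a) = c • (g • a) :=
  map_smul (FreeGroup.lift (gen J) g) c a

/-- the action is multiplicative -/
theorem smul_mul' (g : G) (a b : HXS J) : g • (a * b) = g • a * g • b :=
  map_mul (FreeGroup.lift (gen J) g) a b

/-! ## Central elements on the first-curve summands -/

/-- a central element commutes with the generators on `U` -/
theorem center_smul_genU {z : G} (hz : z ∈ Subgroup.center G) (s : Bool × Option ℕ) (u : U) :
    z • genU s u = genU s (z • u) := by
  rw [← of_smul_U, ← of_smul_U, ← mul_smul, ← mul_smul, Subgroup.mem_center_iff.1 hz (FreeGroup.of s)]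

/-- the action of `z` as an operator on `Ω → ℂ` (zero outside `U`) -/
def opU (z : G) (f : Ω → ℂ) : Ω → ℂ :=
  open scoped Classical in if h : f ∈ Usub then ((z • (⟨f, h⟩ : U) : U) : Ω → ℂ) else 0

/-- `opU` on `U` -/
theorem opU_apply {z : G} {f : Ω → ℂ} (h : f ∈ Usub) : opU z f = ((z • (⟨f, h⟩ : U) : U) : Ω → ℂ) := by
  unfold opU
  rw [dif_pos h]

/-- `opU` on an element of `U` -/
theorem opU_coe (z : G) (u : U) : opU z u = ((z • u : U) : Ω → ℂ) := opU_apply u.2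

/-- `opU z` commutes with the flips and signs on `Wmod s` for central `z` -/
theorem commutesOn_opU {z : G} (hz : z ∈ Subgroup.center G) (s : ℕ → ℂ) (hs : Wmod s ≤ Usub) :
    CommutesOn s (opU z) where
  map_add f hf g hg := by
    rw [opU_apply (hs hf), opU_apply (hs hg), opU_apply (Usub.add_mem (hs hf) (hs hg))]
    rw [show (⟨f + g, Usub.add_mem (hs hf) (hs hg)⟩ : U) = ⟨f, hs hf⟩ + ⟨g, hs hg⟩ from rfl, smul_add]
    rfl
  map_smul c f hf := by
    rw [opU_apply (hs hf), opU_apply (Usub.smul_mem c (hs hf))]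
    rw [show (⟨c • f, Usub.smul_mem c (hs hf)⟩ : U) = c • ⟨f, hs hf⟩ from rfl, smul_comm_U]
    rfl
  mem f hf := by
    rw [opU_apply (hs hf)]
    exact smul_mem_WU s z (u := ⟨f, hs hf⟩) hf
  flip_comm n f hf := by
    rw [opU_apply (hs hf), opU_apply (hs ((Wmod_stable s).flip_mem n f hf))]
    rw [show (⟨flip n f, hs ((Wmod_stable s).flip_mem n f hf)⟩ : U) = genU (false, some n) ⟨f, hs hf⟩ from
      rfl, center_smul_genU hz]
    rfl
  sgn_comm n f hf := by
    rw [opU_apply (hs hf), opU_apply (hs ((Wmod_stable s).sgn_mem n f hf))]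
    rw [show (⟨sgn n f, hs ((Wmod_stable s).sgn_mem n f hf)⟩ : U) = genU (true, some n) ⟨f, hs hf⟩ from
      rfl, center_smul_genU hz]
    rfl

/-- (H11a) on the first-curve summands: a central element acts by a scalar on `omegaA s` -/
theorem exists_scalar_omegaA {z : G} (hz : z ∈ Subgroup.center G) (s : ℕ → ℂ) (hs : Wmod s ≤ Usub) :
    ∃ c : ℂ, ∀ a : HXS J, a ∈ omegaA s → z • a = c • a := by
  obtain ⟨c, hc⟩ := (commutesOn_opU hz s hs).exists_scalar
  refine ⟨c, ?_⟩
  rintro _ ⟨u, hu, rfl⟩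
  rw [ιAL_apply, smul_ιA]
  have : z • u = c • u := Subtype.ext (by rw [← opU_coe, hc u hu]; rfl)
  rw [this, ← ιAL_apply, ← ιAL_apply, map_smul]

/-! ## Central elements on `E2` -/

/-- (H11a) on `E2`: a central element acts by a scalar -/
theorem exists_scalar_E2 {z : G} (hz : z ∈ Subgroup.center G) :
    ∃ c : ℂ, ∀ a : HXS J, a ∈ E2 → z • a = c • a := by
  obtain ⟨p, q, hpq⟩ := Submodule.mem_span_pair.1 (heckeStable_E2 (J := J) z _ (eH_mem_E2 0))
  have hsign : (FreeGroup.of (true, none) : G) • (z • (eH 0 : HXS J)) = z • eH 0 := by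
    rw [← mul_smul, Subgroup.mem_center_iff.1 hz, mul_smul, of_smul, gen_eH_sign, signK_zero, one_smul]
  rw [← hpq, of_smul, map_add, map_smul, map_smul, gen_eH_sign, gen_eH_sign, signK_zero, signK_one,
    one_smul] at hsign
  have hq : q = 0 := by
    have h2 : (0 : ℂ) • (eH 0 : HXS J) + (-(2 * q)) • eH 1 = 0 := by
      rw [← sub_eq_zero.2 hsign]
      module
    have := (eH_linearIndependent h2).2
    rw [neg_eq_zero] at this
    exact (mul_eq_zero.1 this).resolve_left two_ne_zero
  rw [hq, zero_smul, add_zero] at hpq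
  have h1 : z • (eH 1 : HXS J) = p • eH 1 := by
    have hsw : (eH 1 : HXS J) = (FreeGroup.of (false, none) : G) • (eH 0 : HXS J) := by
      rw [of_smul, gen_eH_swap, Equiv.swap_apply_left]
    rw [hsw, ← mul_smul, ← Subgroup.mem_center_iff.1 hz, mul_smul, ← hpq, smul_smul', of_smul, gen_eH_swap,
      Equiv.swap_apply_left]
  refine ⟨p, fun a ha => ?_⟩
  obtain ⟨x, y, rfl⟩ := Submodule.mem_span_pair.1 ha
  rw [smul_add', smul_smul', smul_smul', ← hpq, h1, smul_add, smul_comm p x, smul_comm p y]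

/-! ## The product of the theta classes is a multiple of the top class -/

/-- the top class `t₁ t₂` of `HXS J` -/
def topT : HXS J := ⟨0, 0, topA, 0⟩

/-- `incA topA * topH = t₁ t₂` -/
theorem incA_topA_mul_topH : (incA topA : HXS J) * topH = topT := by
  refine Curve.ext ?_ ?_ ?_ ?_
  · rw [Curve.mul_c]; simp [incA, topH, topT]
  · rw [Curve.mul_v]; simp [incA, topH, topT]
  · rw [Curve.mul_t]; simp [incA, topH, topT]
  · rw [Curve.mul_j]; simp [incA, topH, topT]

/-- `σ₁ 0 = 0` for a generator datum: every `A₁`-automorphism fixes the top class of the first curve -/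
theorem UAut.algEquiv₁_topA (a : UAut) : a.algEquiv₁ topA = topA := by
  rw [UAut.algEquiv₁_apply]
  simp [topA]

/-- a generator datum fixing `topA` fixes `topT` -/
theorem HAutData.algEquiv_topT (D : HAutData) (hD : D.σ₁ topA = topA) :
    D.algEquiv (topT : HXS J) = topT := by
  rw [HAutData.algEquiv_apply]
  refine Curve.ext (by simp [topT]) (by simp [topT, HAutData.actFun_zero]) ?_ rfl
  exact hD

/-- the generators fix the top class -/
theorem gen_topT (s : Bool × Option ℕ) : gen J s topT = topT := by
  rcases s with ⟨b, n⟩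
  rcases b with _ | _ <;> rcases n with _ | n
  · exact HAutData.algEquiv_topT _ rfl
  · exact HAutData.algEquiv_topT _ ((UAut.flip n).algEquiv₁_topA)
  · exact HAutData.algEquiv_topT _ rfl
  · exact HAutData.algEquiv_topT _ ((UAut.sgn n).algEquiv₁_topA)

/-- `G` fixes the top class -/
theorem smul_topT (g : G) : g • (topT : HXS J) = topT :=
  lift_gen_prop (J := J) (fun φ => φ topT = topT) (by simp) gen_topT
    (fun φ ψ hφ hψ => by rw [AlgEquiv.mul_apply, hψ, hφ]) g

/-- `intX topT = 1` -/
theorem intX_topT : intX (topT : HXS J) = 1 := rfl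

/-- `barH` of a first-curve class -/
theorem barH_ιA (jb : JBar J) (u : U) : barH jb (ιA u) = ⟨antiA (conjU u), 0, 0, 0⟩ := by
  rw [barH_apply]
  simp only [ιA, bar₁_holA]
  exact Curve.ext rfl (Prod.ext (funext fun _ => bar₁_zero) (funext fun _ => bar₁_zero)) bar₁_zero jb.b_zero

/-- `ιA u * conj (ιA w) = ⟨u, w̄⟩ · t₁` -/
theorem ιA_mul_barH_ιA (jb : JBar J) (u w : U) :
    (ιA u : HXS J) * barH jb (ιA w) = Bform u (conjU w) • incA topA := by
  rw [barH_ιA]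
  refine Curve.ext ?_ ?_ ?_ ?_
  · rw [Curve.mul_c]; simp [ιA, holA_mul_antiA]
  · rw [Curve.mul_v]; simp [ιA]
  · rw [Curve.mul_t]; simp [ιA]
  · rw [Curve.mul_j]; simp [ιA]

/-- `barH` of `e k` -/
theorem barH_eH (jb : JBar J) (k : Fin 2) : barH jb (eH k) = eHbar k := by
  rw [barH_apply]
  simp only [eH, eHbar, bar₁_zero, Pi.zero_apply]
  refine Curve.ext rfl (Prod.ext (funext fun _ => rfl) (funext fun j => ?_)) rfl jb.b_zero
  simp only [Pi.single_apply]
  split_ifs <;> simp [bar₁_one, bar₁_zero]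

/-- the product of two classes of `E2` and its conjugate is a multiple of `t₂` -/
theorem E2_mul_barH_E2 (jb : JBar J) {a b : HXS J} (ha : a ∈ E2) (hb : b ∈ E2) :
    ∃ γ : ℂ, a * barH jb b = γ • topH := by
  obtain ⟨p, q, rfl⟩ := Submodule.mem_span_pair.1 ha
  obtain ⟨p', q', rfl⟩ := Submodule.mem_span_pair.1 hb
  refine ⟨(starRingEnd ℂ) p' * p + (starRingEnd ℂ) q' * q, ?_⟩
  rw [barH_add, barH_smul, barH_smul, barH_eH, barH_eH]
  simp only [add_mul, mul_add, smul_mul_assoc, mul_smul_comm, eH_mul_eHbar, if_true, one_ne_zero,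
    zero_ne_one, if_false, smul_zero, add_zero, zero_add, Fin.isValue, smul_smul]
  rw [add_smul]

/-- (H11b) THE PRODUCT: `θ₀ θ₁ · conj(θ₂ θ₃)` is a multiple of `t₁ t₂` -/
theorem prod_eq_smul_topT (jb : JBar J) {a0 a1 a2 a3 : HXS J} (h0 : a0 ∈ omegaA 0) (h1 : a1 ∈ E2)
    (h2 : a2 ∈ omegaA sq) (h3 : a3 ∈ E2) : ∃ c : ℂ, a0 * a1 * barH jb (a2 * a3) = c • topT := by
  obtain ⟨u0, _, rfl⟩ := mem_omegaA.1 h0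
  obtain ⟨u2, _, rfl⟩ := mem_omegaA.1 h2
  obtain ⟨γ, hγ⟩ := E2_mul_barH_E2 jb h1 h3
  refine ⟨Bform u0 (conjU u2) * γ, ?_⟩
  rw [barH_mul, show ιA u0 * a1 * (barH jb (ιA u2) * barH jb a3) =
    (ιA u0 * barH jb (ιA u2)) * (a1 * barH jb a3) by ring, hγ, ιA_mul_barH_ιA, smul_mul_smul_comm,
    incA_topA_mul_topH]

/-- (H11b): the centre (indeed all of `G`) fixes `θ₀ θ₁ · conj(θ₂ θ₃)` -/
theorem center_fixes_prod (jb : JBar J) (z : G) {a0 a1 a2 a3 : HXS J} (h0 : a0 ∈ omegaA 0) (h1 : a1 ∈ E2)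
    (h2 : a2 ∈ omegaA sq) (h3 : a3 ∈ E2) :
    z • (a0 * a1 * barH jb (a2 * a3)) = a0 * a1 * barH jb (a2 * a3) := by
  obtain ⟨c, hc⟩ := prod_eq_smul_topT jb h0 h1 h2 h3
  rw [hc, smul_smul', smul_topT]

end

end Summit.Ventures.HodgeRepro2.Tier7.Line1.Sep
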